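import Literature.NumberTheory.LFunctions.ZetaUniversalityDiscTorus
import Literature.NumberTheory.DiophantineApproximation.PankowskiLemma
import HarnessLib

/-!
# Hybrid joint universality — finite Euler products on the torus `(ℝ/ℤ)^{J ⊔ primes<P}`

Topic `Literature/NumberTheory/LFunctions` (namespace `Literature.NumberTheory.LFunctions`,
grouping sub-namespace `HybridTorus`). Everything in this file is PROVED. It is the torus
bookkeeping of the proof of Lemma 3.1 of Ł. Pańkowski, *Hybrid joint universality theorem for
Dirichlet L-functions*, Acta Arith. 141 (2010), pp. 64–67 — the `χ`-twisted, hybrid version of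
the tree's `ZetaUniversalityDiscTorus.lean` (Voronin's theorem for `ζ`), for the inline discharge
of `Literature.NumberTheory.LFunctions.Pankowski2010_thm1_1_discAnalytic`. The torus is
`(ℝ/ℤ)^{J ⊔ {primes < P}}` (`J` the admissible indices of the Diophantine lemma
`Pankowski.exists_hybrid_frequencies`, `PankowskiLemma.lean`), the flow has the frequencies
`α_j/Nn` on `J` and `−ℓ(p)/Nn` (`p ∈ B` exceptional), `−ℓ(p)` (`p ∉ B`), `ℓ(p) = log p/2π`
(`freq`; their `ℤ`-independence is `Pankowski.linearIndependent_int_frequencies`), which is the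
source's curve `γ(τ) = (τ αᵢ)_{i∈J} ⌢ (τ log p/2π)_{p∈B} ⌢ (τ N log p/2π)_{p∈Q}` after the
rescaling `τ ↦ τ/N` (p. 66):

* `eph`, `eph_flow` — the phase of the prime `n` read off the torus point (`e(θ_n)`, or
  `e(Nn θ_n)` for `n ∈ B`) is `n^{−it}` along the flow, for EVERY prime `n < P`;
* `Zst`, `Qtl`, `Lt`, `eulerProduct_flow_split` — for a coefficient `a` (the values of a
  Dirichlet character) the twisted Euler product along the flow splits as steering product over
  the steering primes `St ⊇ B` times tail product over the remaining primes below `P`: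
  `∏_{n<P}(1 − a(n) n^{−(s+it)})⁻¹ = Z(s, flow t) · Q(s, flow t)`;
* `norm_Qtl_sub_one_le`, `sum_sq_Tl_le_tail` — the tail product is within
  `2(‖L(s,θ)‖ + Σ q^{−2 Re s})` of `1`, `L` the tail sum, and `Σ_{tail} q^{−2Re s}` is a tail of
  `Σ k^{−2σ₁}`;
* `continuous_Lt`, `continuousOn_Zst`, `continuous_circleMeanSquare_Lt`,
  `integral_mul_circleMeanSquare_Lt_le` — continuity, and the torus average of the weighted circle
  mean square of the tail sum: `∫ φ(θ) ∫₀^{2π} |L(c + ρ'e^{iα}, θ)|² dα dθ ≤ 2π (Σ_{tail} q^{−2σ₁}) ∫ φ`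
  for weights `φ` not depending on the tail coordinates (Fubini and orthogonality,
  `ShiftsOnDiscs.integral_mul_norm_sq_sum_fourier_complex`; the source's appeal to
  "Theorem A.8.3 in [KV]" for `S₁`).

## References

* [Pankowski2010] Ł. Pańkowski, *Hybrid joint universality theorem for Dirichlet L-functions*,
  Acta Arith. 141 (2010), 59–72: proof of Lemma 3.1 (pp. 65–67).
* [Steuding2007] J. Steuding, *Value-Distribution of L-Functions*, LNM 1877, §1.3 (1.22)–(1.26).
-/

noncomputable section

open Complex Filter Set Metric MeasureTheory
open scoped Real

namespace Literature.NumberTheory.LFunctions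

namespace HybridTorus

open Literature.NumberTheory.DiophantineApproximation
open Literature.Barriers.RiemannHypothesis.BohrCourant
open Literature.Barriers.RiemannHypothesis.ShiftsOnDiscs
open VoroninTorus

variable {κ : Type} (J : Finset κ) (P : ℕ)

/-! ### The phase of a prime coordinate, and the flow -/

/-- The phase `e_n(θ)` of the prime `n` at the torus point `θ ∈ (ℝ/ℤ)^{J ⊔ primes<P}`: the
character `e(θ_n)` of its coordinate, except for the exceptional primes `n ∈ B` whose coordinate
runs `Nn` times slower and whose phase is `e(Nn θ_n)`; primes `n ≥ P` get phase `1`.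
[cite: Pankowski2010, Lemma 3.1 (proof: the curve γ(τ))] -/
def eph (B : Finset ℕ) (Nn : ℕ) (θ : UnitAddTorus (↥J ⊕ ↥(P.primesBelow))) (n : ℕ) : ℂ :=
  if h : n ∈ P.primesBelow then
    (if n ∈ B then fourier (Nn : ℤ) (θ (Sum.inr ⟨n, h⟩)) else fourier 1 (θ (Sum.inr ⟨n, h⟩)))
  else 1

/-- `|e_n(θ)| = 1`. [folklore] -/
theorem norm_eph (B : Finset ℕ) (Nn : ℕ) (θ : UnitAddTorus (↥J ⊕ ↥(P.primesBelow))) (n : ℕ) :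
    ‖eph J P B Nn θ n‖ = 1 := by
  unfold eph
  split_ifs
  · rw [fourier_apply]; exact Circle.norm_coe _
  · exact norm_fourier_one _
  · exact norm_one

/-- `θ ↦ e_n(θ)` is continuous. [folklore] -/
theorem continuous_eph (B : Finset ℕ) (Nn : ℕ) (n : ℕ) :
    Continuous fun θ : UnitAddTorus (↥J ⊕ ↥(P.primesBelow)) ↦ eph J P B Nn θ n := by
  unfold eph
  split_ifs with h hB
  · exact (fourier (Nn : ℤ)).continuous.comp (continuous_apply _)
  · exact (fourier 1).continuous.comp (continuous_apply _)
  · exact continuous_const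

/-- `e_n` only depends on the coordinate `n`: translating another coordinate does not change it.
[folklore] -/
theorem eph_add_single [DecidableEq κ] (B : Finset ℕ) (Nn : ℕ)
    (θ : UnitAddTorus (↥J ⊕ ↥(P.primesBelow))) (n : ℕ)
    {x : ↥J ⊕ ↥(P.primesBelow)} (hx : ∀ h : n ∈ P.primesBelow, x ≠ Sum.inr ⟨n, h⟩)
    (a : UnitAddCircle) : eph J P B Nn (θ + Pi.single x a) n = eph J P B Nn θ n := by
  unfold eph
  split_ifs with h hB
  · rw [Pi.add_apply, Pi.single_eq_of_ne (hx h).symm, add_zero]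
  · rw [Pi.add_apply, Pi.single_eq_of_ne (hx h).symm, add_zero]
  · rfl

/-- The frequencies of the flow: `α_j/Nn` on `J`, and `−ℓ(p)/Nn` (`p ∈ B`), `−ℓ(p)` (`p ∉ B`) on
the primes, `ℓ(p) = log p/2π` (`Pankowski.ell`). [cite: Pankowski2010, Lemma 2.2 and Lemma 3.1 (proofs)] -/
def freq (B : Finset ℕ) (Nn : ℕ) (α : κ → ℝ) : ↥J ⊕ ↥(P.primesBelow) → ℝ :=
  Sum.elim (fun j : ↥J ↦ α j / Nn)
    (fun p : ↥(P.primesBelow) ↦ -(if (p : ℕ) ∈ B then Pankowski.ell p / Nn else Pankowski.ell p))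

/-- The linear flow `t ↦ (t · freq)` on the torus. [folklore] -/
def flow (B : Finset ℕ) (Nn : ℕ) (α : κ → ℝ) (t : ℝ) : UnitAddTorus (↥J ⊕ ↥(P.primesBelow)) :=
  fun x ↦ ((t * freq J P B Nn α x : ℝ) : UnitAddCircle)

/-- The flow is continuous. [folklore] -/
theorem continuous_flow (B : Finset ℕ) (Nn : ℕ) (α : κ → ℝ) : Continuous (flow J P B Nn α) :=
  KroneckerWeyl.continuous_flow _

/-- The prime power `n^{-it}` as an exponential: `n^{-it} = exp(−it log n)`. [folklore] -/
theorem natCast_cpow_neg_mul_I_eq_exp {n : ℕ} (hn : n ≠ 0) (t : ℝ) :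
    (n : ℂ) ^ (-((t : ℂ) * I)) = Complex.exp (-(t * Real.log n) * I) := by
  have hn' : (n : ℂ) ≠ 0 := by exact_mod_cast hn
  rw [Complex.cpow_def_of_ne_zero hn', ← Complex.natCast_log]
  congr 1
  ring

/-- **Along the flow every prime phase is the prime power**: `e_n(flow t) = n^{-it}` for `n < P`
prime (`Nn ≥ 1`). For `n ∈ B` this is `e(Nn · (−t ℓ(n)/Nn)) = e(−t ℓ(n)) = n^{-it}`.
[cite: Pankowski2010, Lemma 3.1 (proof)] -/
theorem eph_flow (B : Finset ℕ) {Nn : ℕ} (hNn : 0 < Nn) (α : κ → ℝ) (t : ℝ) {n : ℕ}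
    (hn : n ∈ P.primesBelow) :
    eph J P B Nn (flow J P B Nn α t) n = (n : ℂ) ^ (-((t : ℂ) * I)) := by
  have hn0 : n ≠ 0 := (Nat.prime_of_mem_primesBelow hn).ne_zero
  have hNn0 : (Nn : ℂ) ≠ 0 := by exact_mod_cast hNn.ne'
  have hπ : (Real.pi : ℂ) ≠ 0 := by exact_mod_cast Real.pi_ne_zero
  rw [natCast_cpow_neg_mul_I_eq_exp hn0]
  unfold eph
  rw [dif_pos hn]
  simp only [flow, freq, Sum.elim_inr]
  split_ifs with hB
  · rw [fourier_coe_apply]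
    congr 1
    rw [Pankowski.ell]
    push_cast
    field_simp
  · rw [fourier_coe_apply]
    congr 1
    rw [Pankowski.ell]
    push_cast
    field_simp

/-- The coordinate character of a non-exceptional prime along the flow: `e(flow_q t) = q^{-it}`
(`q ∉ B`). [folklore] -/
theorem fourier_one_flow_inr (B : Finset ℕ) (Nn : ℕ) (α : κ → ℝ) (t : ℝ) {q : ↥(P.primesBelow)}
    (hq : (q : ℕ) ∉ B) :
    fourier 1 (flow J P B Nn α t (Sum.inr q)) = ((q : ℕ) : ℂ) ^ (-((t : ℂ) * I)) := by
  have hn0 : (q : ℕ) ≠ 0 := (Nat.prime_of_mem_primesBelow q.2).ne_zero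
  have hπ : (Real.pi : ℂ) ≠ 0 := by exact_mod_cast Real.pi_ne_zero
  rw [natCast_cpow_neg_mul_I_eq_exp hn0]
  simp only [flow, freq, Sum.elim_inr, if_neg hq]
  rw [fourier_coe_apply]
  congr 1
  rw [Pankowski.ell]
  push_cast
  field_simp

/-! ### Steering product, tail product and tail sum -/

/-- The steering product over the steering primes `St` (those below `P`), coefficient `a`
(`a = χ` on the primes): `Z(s, θ) = ∏_{n<P, n∈St} (1 − a(n) n^{-s} e_n(θ))⁻¹`.
[cite: Pankowski2010, Lemma 3.1 (proof: F_{j,M}(s, Θ))] -/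
def Zst (B : Finset ℕ) (Nn : ℕ) (St : Finset ℕ) (a : ℕ → ℂ) (s : ℂ)
    (θ : UnitAddTorus (↥J ⊕ ↥(P.primesBelow))) : ℂ :=
  ∏ n ∈ (P.primesBelow).filter (· ∈ St), (1 - a n * (n : ℂ) ^ (-s) * eph J P B Nn θ n)⁻¹

/-- The tail coordinates: primes below `P` outside `St`. [folklore] -/
def Tl (St : Finset ℕ) : Finset ↥(P.primesBelow) := Finset.univ.filter (fun q ↦ (q : ℕ) ∉ St)

/-- The tail sum `L(s, θ) = Σ_{q ∈ Tl} a(q) q^{-s} e(θ_q)`. [cite: Pankowski2010, Lemma 3.1 (proof)] -/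
def Lt (St : Finset ℕ) (a : ℕ → ℂ) (s : ℂ) (θ : UnitAddTorus (↥J ⊕ ↥(P.primesBelow))) : ℂ :=
  ∑ q ∈ Tl P St, a q * ((q : ℕ) : ℂ) ^ (-s) * fourier 1 (θ (Sum.inr q))

/-- The tail product `Q(s, θ) = ∏_{q ∈ Tl} (1 − a(q) q^{-s} e(θ_q))⁻¹`.
[cite: Pankowski2010, Lemma 3.1 (proof: F_{j,Q∖M_k})] -/
def Qtl (St : Finset ℕ) (a : ℕ → ℂ) (s : ℂ) (θ : UnitAddTorus (↥J ⊕ ↥(P.primesBelow))) : ℂ :=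
  ∏ q ∈ Tl P St, (1 - a q * ((q : ℕ) : ℂ) ^ (-s) * fourier 1 (θ (Sum.inr q)))⁻¹

/-- **The Euler product along the flow splits into steering and tail products**:
`∏_{n<P} (1 − a(n) n^{−(s+it)})⁻¹ = Z(s, flow t) · Q(s, flow t)` (for `B ⊆ St`, `Nn ≥ 1`).
[cite: Pankowski2010, Lemma 3.1 (proof)] -/
theorem eulerProduct_flow_split (B : Finset ℕ) {Nn : ℕ} (hNn : 0 < Nn) {St : Finset ℕ} (hBSt : B ⊆ St)
    (a : ℕ → ℂ) (α : κ → ℝ) (s : ℂ) (t : ℝ) :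
    ∏ n ∈ P.primesBelow, (1 - a n * (n : ℂ) ^ (-(s + t * I)))⁻¹ =
      Zst J P B Nn St a s (flow J P B Nn α t) * Qtl J P St a s (flow J P B Nn α t) := by
  classical
  rw [← Finset.prod_filter_mul_prod_filter_not (P.primesBelow) (· ∈ St)]
  congr 1
  · unfold Zst
    refine Finset.prod_congr rfl fun n hn ↦ ?_
    have hnP : n ∈ P.primesBelow := (Finset.mem_filter.1 hn).1
    have hn0 : n ≠ 0 := (Nat.prime_of_mem_primesBelow hnP).ne_zero
    rw [eph_flow J P B hNn α t hnP, natCast_cpow_neg_add_mul_I hn0, mul_assoc]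
  · unfold Qtl Tl
    have h1 : ∏ q ∈ Finset.univ.filter (fun q : ↥(P.primesBelow) ↦ (q : ℕ) ∉ St),
        (1 - a q * ((q : ℕ) : ℂ) ^ (-s) * fourier 1 (flow J P B Nn α t (Sum.inr q)))⁻¹ =
        ∏ q ∈ Finset.univ.filter (fun q : ↥(P.primesBelow) ↦ (q : ℕ) ∉ St),
          (1 - a q * ((q : ℕ) : ℂ) ^ (-s) * ((q : ℕ) : ℂ) ^ (-((t : ℂ) * I)))⁻¹ := by
      refine Finset.prod_congr rfl fun q hq ↦ ?_
      have hqSt : (q : ℕ) ∉ St := (Finset.mem_filter.1 hq).2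
      have hqB : (q : ℕ) ∉ B := fun h ↦ hqSt (hBSt h)
      rw [fourier_one_flow_inr J P B Nn α t hqB]
    rw [h1, prod_univ_filter_coe (P.primesBelow) (fun n ↦ n ∉ St)
      (fun n ↦ (1 - a n * (n : ℂ) ^ (-s) * (n : ℂ) ^ (-((t : ℂ) * I)))⁻¹)]
    refine Finset.prod_congr rfl fun n hn ↦ ?_
    have hn0 : n ≠ 0 := (Nat.prime_of_mem_primesBelow (Finset.mem_filter.1 hn).1).ne_zero
    rw [natCast_cpow_neg_add_mul_I hn0, mul_assoc]

/-! ### Sizes -/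

/-- The local datum `a(n) n^{-s} e` with `|a(n)| ≤ 1`, `|e| = 1` has norm `≤ n^{-Re s}` (`n ≥ 1`).
[folklore] -/
theorem norm_datum_le {a : ℕ → ℂ} (ha : ∀ n, ‖a n‖ ≤ 1) {n : ℕ} (hn : n ≠ 0) (s : ℂ) {e : ℂ}
    (he : ‖e‖ = 1) : ‖a n * (n : ℂ) ^ (-s) * e‖ ≤ (n : ℝ) ^ (-s.re) := by
  rw [norm_mul, norm_mul, he, mul_one, norm_natCast_cpow_neg hn]
  calc ‖a n‖ * (n : ℝ) ^ (-s.re) ≤ 1 * (n : ℝ) ^ (-s.re) := by gcongr; exact ha n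
    _ = (n : ℝ) ^ (-s.re) := one_mul _

/-- **The tail product is close to `1`**: if every tail prime is `≥ 4`, `Re s > 1/2`, `|a| ≤ 1`, and
`‖L(s,θ)‖ + Σ_{q∈Tl} q^{-2 Re s} ≤ 1`, then `‖Q(s,θ) − 1‖ ≤ 2 (‖L(s,θ)‖ + Σ_{q∈Tl} q^{-2 Re s})`.
[cite: Pankowski2010, Lemma 3.1 (proof: F_{j,Q∖M_k}(s, ω) − 1)] -/
theorem norm_Qtl_sub_one_le {St : Finset ℕ} (h4 : ∀ q ∈ Tl P St, 4 ≤ (q : ℕ)) {a : ℕ → ℂ}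
    (ha : ∀ n, ‖a n‖ ≤ 1) {s : ℂ} (hs : 1 / 2 < s.re) (θ : UnitAddTorus (↥J ⊕ ↥(P.primesBelow)))
    (hsmall : ‖Lt J P St a s θ‖ + ∑ q ∈ Tl P St, (((q : ℕ) : ℝ) ^ (-s.re)) ^ 2 ≤ 1) :
    ‖Qtl J P St a s θ - 1‖ ≤
      2 * (‖Lt J P St a s θ‖ + ∑ q ∈ Tl P St, (((q : ℕ) : ℝ) ^ (-s.re)) ^ 2) := by
  have hnorm : ∀ q ∈ Tl P St,
      ‖a q * ((q : ℕ) : ℂ) ^ (-s) * fourier 1 (θ (Sum.inr q))‖ ≤ ((q : ℕ) : ℝ) ^ (-s.re) :=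
    fun q _ ↦ norm_datum_le ha (Nat.prime_of_mem_primesBelow q.2).ne_zero s (norm_fourier_one _)
  have hz : ∀ q ∈ Tl P St, ‖a q * ((q : ℕ) : ℂ) ^ (-s) * fourier 1 (θ (Sum.inr q))‖ ≤ 1 / 2 :=
    fun q hq ↦ (hnorm q hq).trans (rpow_neg_le_half (h4 q hq) hs)
  have hsq : ∑ q ∈ Tl P St, ‖a q * ((q : ℕ) : ℂ) ^ (-s) * fourier 1 (θ (Sum.inr q))‖ ^ 2 ≤
      ∑ q ∈ Tl P St, (((q : ℕ) : ℝ) ^ (-s.re)) ^ 2 :=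
    Finset.sum_le_sum fun q hq ↦ pow_le_pow_left₀ (norm_nonneg _) (hnorm q hq) 2
  have h := FiniteEulerPhases.norm_prod_inv_one_sub_sub_one_le (Tl P St) hz (by
    unfold Lt at hsmall; linarith)
  unfold Qtl Lt
  unfold Lt at hsmall
  linarith

/-- The tail data: `Σ_{q∈Tl} q^{-2 Re s} ≤ Σ_{k≥0} (k + y)^{-2σ₁}` if all tail primes are `≥ y` and
`Re s ≥ σ₁ > 1/2`. [folklore] -/
theorem sum_sq_Tl_le_tail {St : Finset ℕ} {y : ℕ} (hy : ∀ q ∈ Tl P St, y ≤ (q : ℕ)) {σ₁ : ℝ}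
    (hσ₁ : 1 / 2 < σ₁) {s : ℂ} (hs : σ₁ ≤ s.re) :
    ∑ q ∈ Tl P St, (((q : ℕ) : ℝ) ^ (-s.re)) ^ 2 ≤ ∑' k : ℕ, ((k + y : ℕ) : ℝ) ^ (-(2 * σ₁)) := by
  have e : ∀ n : ℕ, ((n : ℝ) ^ (-s.re)) ^ 2 = (n : ℝ) ^ (-(2 * s.re)) := by
    intro n
    rw [← Real.rpow_natCast, ← Real.rpow_mul (Nat.cast_nonneg n)]
    congr 1; push_cast; ring
  have hle : ∀ q ∈ Tl P St, (((q : ℕ) : ℝ) ^ (-s.re)) ^ 2 ≤ ((q : ℕ) : ℝ) ^ (-(2 * σ₁)) := by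
    intro q _
    rw [e]
    have hq1 : (1 : ℝ) ≤ (q : ℕ) := by exact_mod_cast (Nat.prime_of_mem_primesBelow q.2).one_lt.le
    exact Real.rpow_le_rpow_of_exponent_le hq1 (by linarith)
  calc ∑ q ∈ Tl P St, (((q : ℕ) : ℝ) ^ (-s.re)) ^ 2 ≤ ∑ q ∈ Tl P St, ((q : ℕ) : ℝ) ^ (-(2 * σ₁)) :=
        Finset.sum_le_sum hle
    _ = ∑ n ∈ (P.primesBelow).filter (· ∉ St), (n : ℝ) ^ (-(2 * σ₁)) := by
        unfold Tl
        exact sum_univ_filter_coe (P.primesBelow) (fun n ↦ n ∉ St) (fun n ↦ (n : ℝ) ^ (-(2 * σ₁)))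
    _ ≤ ∑ n ∈ Finset.Ico y P, (n : ℝ) ^ (-(2 * σ₁)) := by
        refine Finset.sum_le_sum_of_subset_of_nonneg (fun n hn ↦ ?_) fun n _ _ ↦ by positivity
        rw [Finset.mem_filter, Nat.mem_primesBelow] at hn
        rw [Finset.mem_Ico]
        refine ⟨?_, hn.1.1⟩
        have := hy ⟨n, Nat.mem_primesBelow.2 hn.1⟩ (by unfold Tl; simpa using hn.2)
        exact this
    _ ≤ ∑' k : ℕ, ((k + y : ℕ) : ℝ) ^ (-(2 * σ₁)) := EulerProductMeanSquare.sum_Ico_rpow_le_tsum hσ₁ y P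

/-! ### Continuity -/

/-- The tail sum is jointly continuous in `(s, θ)`. [folklore] -/
theorem continuous_Lt (St : Finset ℕ) (a : ℕ → ℂ) :
    Continuous fun p : ℂ × UnitAddTorus (↥J ⊕ ↥(P.primesBelow)) ↦ Lt J P St a p.1 p.2 := by
  unfold Lt
  refine continuous_finsetSum _ fun q _ ↦ ?_
  have hq : ((q : ℕ) : ℂ) ≠ 0 := by exact_mod_cast (Nat.prime_of_mem_primesBelow q.2).ne_zero
  exact (continuous_const.mul (Continuous.const_cpow continuous_fst.neg (Or.inl hq))).mul
    ((fourier 1).continuous.comp ((continuous_apply _).comp continuous_snd))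

/-- The steering product is jointly continuous in `(s, θ)` for `Re s > 0` (`|a| ≤ 1`: the factors do
not vanish). [folklore] -/
theorem continuousOn_Zst (B : Finset ℕ) (Nn : ℕ) (St : Finset ℕ) {a : ℕ → ℂ} (ha : ∀ n, ‖a n‖ ≤ 1) :
    ContinuousOn (fun p : ℂ × UnitAddTorus (↥J ⊕ ↥(P.primesBelow)) ↦ Zst J P B Nn St a p.1 p.2)
      ({s : ℂ | 0 < s.re} ×ˢ univ) := by
  unfold Zst
  refine continuousOn_finsetProd _ fun n hn ↦ ?_
  have hnP : n ∈ P.primesBelow := (Finset.mem_filter.1 hn).1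
  have hpr := Nat.prime_of_mem_primesBelow hnP
  have hn0 : (n : ℂ) ≠ 0 := by exact_mod_cast hpr.ne_zero
  have hc : Continuous fun p : ℂ × UnitAddTorus (↥J ⊕ ↥(P.primesBelow)) ↦
      (1 : ℂ) - a n * (n : ℂ) ^ (-p.1) * eph J P B Nn p.2 n :=
    continuous_const.sub ((continuous_const.mul (Continuous.const_cpow continuous_fst.neg
      (Or.inl hn0))).mul ((continuous_eph J P B Nn n).comp continuous_snd))
  refine hc.continuousOn.inv₀ fun p hp ↦ ?_
  intro h
  have hlt : ‖a n * (n : ℂ) ^ (-p.1) * eph J P B Nn p.2 n‖ < 1 := by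
    refine (norm_datum_le ha hpr.ne_zero p.1 (norm_eph J P B Nn p.2 n)).trans_lt ?_
    have hre : 0 < p.1.re := hp.1
    exact Real.rpow_lt_one_of_one_lt_of_neg (by exact_mod_cast hpr.one_lt) (by linarith)
  rw [sub_eq_zero] at h
  rw [← h, norm_one] at hlt
  exact lt_irrefl _ hlt

/-- The circle mean square of the tail sum is continuous on the torus. [folklore] -/
theorem continuous_circleMeanSquare_Lt (St : Finset ℕ) (a : ℕ → ℂ) (c : ℂ) (ρ' : ℝ) :
    Continuous fun θ : UnitAddTorus (↥J ⊕ ↥(P.primesBelow)) ↦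
      ∫ α in (0 : ℝ)..2 * π, ‖Lt J P St a (circleMap c ρ' α) θ‖ ^ 2 := by
  refine intervalIntegral.continuous_parametric_intervalIntegral_of_continuous' ?_ _ _
  have h := (continuous_Lt J P St a).comp
    (((continuous_circleMap c ρ').comp continuous_snd).prodMk continuous_fst :
      Continuous fun p : UnitAddTorus (↥J ⊕ ↥(P.primesBelow)) × ℝ ↦ (circleMap c ρ' p.2, p.1))
  exact (continuous_norm.comp h).pow 2

/-! ### Torus average of the weighted circle mean square of the tail sum -/

/-- **`∫ φ(θ) ∫₀^{2π} |L(c+ρ'e^{iα}, θ)|² dα dθ ≤ 2π (Σ_{q∈Tl} q^{-2σ₁}) ∫ φ`** for a continuous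
weight `φ ≥ 0` which does not depend on the tail coordinates, `Re ≥ σ₁` on the circle, `|a| ≤ 1`
(Fubini and orthogonality, `ShiftsOnDiscs.integral_mul_norm_sq_sum_fourier_complex`).
[cite: Pankowski2010, Lemma 3.1 (proof: the estimate of S₁ by Theorem A.8.3 of [KV])] -/
theorem integral_mul_circleMeanSquare_Lt_le [DecidableEq κ] (St : Finset ℕ) {a : ℕ → ℂ}
    (ha : ∀ n, ‖a n‖ ≤ 1) {φ : UnitAddTorus (↥J ⊕ ↥(P.primesBelow)) → ℝ} (hφc : Continuous φ)
    (hφ : ∀ q ∈ Tl P St, ∀ (x : UnitAddTorus (↥J ⊕ ↥(P.primesBelow))) (u : UnitAddCircle),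
      φ (x + Pi.single (Sum.inr q) u) = φ x)
    (hφ0 : ∀ θ, 0 ≤ φ θ) (c : ℂ) (ρ' : ℝ) {σ₁ : ℝ} (hσ₁ : ∀ α, σ₁ ≤ (circleMap c ρ' α).re) :
    ∫ θ : UnitAddTorus (↥J ⊕ ↥(P.primesBelow)), φ θ *
        ∫ α in (0 : ℝ)..2 * π, ‖Lt J P St a (circleMap c ρ' α) θ‖ ^ 2 ≤
      2 * π * (∑ q ∈ Tl P St, (((q : ℕ) : ℝ) ^ (-σ₁)) ^ 2) *
        ∫ θ : UnitAddTorus (↥J ⊕ ↥(P.primesBelow)), φ θ := by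
  -- pull the weight inside and swap the integrals
  have e1 : ∀ θ : UnitAddTorus (↥J ⊕ ↥(P.primesBelow)), φ θ *
      ∫ α in (0 : ℝ)..2 * π, ‖Lt J P St a (circleMap c ρ' α) θ‖ ^ 2 =
      ∫ α in (0 : ℝ)..2 * π, φ θ * ‖Lt J P St a (circleMap c ρ' α) θ‖ ^ 2 :=
    fun θ ↦ (intervalIntegral.integral_const_mul _ _).symm
  simp_rw [e1]
  have hFc : Continuous (Function.uncurry fun (α : ℝ) (θ : UnitAddTorus (↥J ⊕ ↥(P.primesBelow))) ↦
      φ θ * ‖Lt J P St a (circleMap c ρ' α) θ‖ ^ 2) := by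
    have h := (continuous_Lt J P St a).comp
      (((continuous_circleMap c ρ').comp continuous_fst).prodMk continuous_snd :
        Continuous fun p : ℝ × UnitAddTorus (↥J ⊕ ↥(P.primesBelow)) ↦ (circleMap c ρ' p.1, p.2))
    exact (hφc.comp continuous_snd).mul ((continuous_norm.comp h).pow 2)
  rw [integral_intervalIntegral_swap hFc (by positivity)]
  -- orthogonality on each circle point: the tail sum as a sum over the torus coordinates
  set S' : Finset (↥J ⊕ ↥(P.primesBelow)) := (Tl P St).map ⟨Sum.inr, Sum.inr_injective⟩ with hS'
  have hsum : ∀ (s : ℂ) (θ : UnitAddTorus (↥J ⊕ ↥(P.primesBelow))), Lt J P St a s θ =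
      ∑ x ∈ S', Sum.elim (fun _ ↦ (0 : ℂ)) (fun q : ↥(P.primesBelow) ↦ a q * ((q : ℕ) : ℂ) ^ (-s)) x *
        fourier 1 (θ x) := by
    intro s θ
    unfold Lt
    rw [hS', Finset.sum_map]
    rfl
  have hφ' : ∀ x ∈ S', ∀ (θ : UnitAddTorus (↥J ⊕ ↥(P.primesBelow))) (u : UnitAddCircle),
      φ (θ + Pi.single x u) = φ θ := by
    intro x hx θ u
    rw [hS', Finset.mem_map] at hx
    obtain ⟨q, hq, rfl⟩ := hx
    exact hφ q hq θ u
  have e2 : ∀ α : ℝ, ∫ θ : UnitAddTorus (↥J ⊕ ↥(P.primesBelow)),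
      φ θ * ‖Lt J P St a (circleMap c ρ' α) θ‖ ^ 2 =
      (∑ x ∈ S', ‖Sum.elim (fun _ ↦ (0 : ℂ))
        (fun q : ↥(P.primesBelow) ↦ a q * ((q : ℕ) : ℂ) ^ (-circleMap c ρ' α)) x‖ ^ 2) *
        ∫ θ : UnitAddTorus (↥J ⊕ ↥(P.primesBelow)), φ θ := by
    intro α
    simp_rw [hsum]
    exact integral_mul_norm_sq_sum_fourier_complex S' _ hφc hφ'
  simp_rw [e2]
  -- the coefficients on the circle are bounded by `q^{-σ₁}`
  have hcoef : ∀ α : ℝ, ∑ x ∈ S', ‖Sum.elim (fun _ ↦ (0 : ℂ))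
      (fun q : ↥(P.primesBelow) ↦ a q * ((q : ℕ) : ℂ) ^ (-circleMap c ρ' α)) x‖ ^ 2 ≤
      ∑ q ∈ Tl P St, (((q : ℕ) : ℝ) ^ (-σ₁)) ^ 2 := by
    intro α
    rw [hS', Finset.sum_map]
    refine Finset.sum_le_sum fun q _ ↦ ?_
    simp only [Function.Embedding.coeFn_mk, Sum.elim_inr]
    have hq0 : (q : ℕ) ≠ 0 := (Nat.prime_of_mem_primesBelow q.2).ne_zero
    have hq1 : (1 : ℝ) ≤ (q : ℕ) := by exact_mod_cast (Nat.prime_of_mem_primesBelow q.2).one_lt.le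
    have h1 : ‖a q * ((q : ℕ) : ℂ) ^ (-circleMap c ρ' α)‖ ≤ ((q : ℕ) : ℝ) ^ (-σ₁) := by
      have h := norm_datum_le ha hq0 (circleMap c ρ' α) norm_one
      rw [mul_one] at h
      exact h.trans (Real.rpow_le_rpow_of_exponent_le hq1 (neg_le_neg (hσ₁ α)))
    exact pow_le_pow_left₀ (norm_nonneg _) h1 2
  have hI0 : 0 ≤ ∫ θ : UnitAddTorus (↥J ⊕ ↥(P.primesBelow)), φ θ := integral_nonneg hφ0
  have hle : ∀ α ∈ Icc (0 : ℝ) (2 * π),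
      (∑ x ∈ S', ‖Sum.elim (fun _ ↦ (0 : ℂ))
        (fun q : ↥(P.primesBelow) ↦ a q * ((q : ℕ) : ℂ) ^ (-circleMap c ρ' α)) x‖ ^ 2) *
        ∫ θ : UnitAddTorus (↥J ⊕ ↥(P.primesBelow)), φ θ ≤
      (∑ q ∈ Tl P St, (((q : ℕ) : ℝ) ^ (-σ₁)) ^ 2) *
        ∫ θ : UnitAddTorus (↥J ⊕ ↥(P.primesBelow)), φ θ :=
    fun α _ ↦ mul_le_mul_of_nonneg_right (hcoef α) hI0
  have hcont : Continuous fun α : ℝ ↦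
      (∑ x ∈ S', ‖Sum.elim (fun _ ↦ (0 : ℂ))
        (fun q : ↥(P.primesBelow) ↦ a q * ((q : ℕ) : ℂ) ^ (-circleMap c ρ' α)) x‖ ^ 2) *
        ∫ θ : UnitAddTorus (↥J ⊕ ↥(P.primesBelow)), φ θ := by
    refine Continuous.mul ?_ continuous_const
    rw [hS']
    simp_rw [Finset.sum_map]
    refine continuous_finsetSum _ fun q _ ↦ ?_
    simp only [Function.Embedding.coeFn_mk, Sum.elim_inr]
    have hq : ((q : ℕ) : ℂ) ≠ 0 := by exact_mod_cast (Nat.prime_of_mem_primesBelow q.2).ne_zero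
    exact (continuous_norm.comp (continuous_const.mul
      (Continuous.const_cpow (continuous_circleMap c ρ').neg (Or.inl hq)))).pow 2
  calc ∫ α in (0 : ℝ)..2 * π, (∑ x ∈ S', ‖Sum.elim (fun _ ↦ (0 : ℂ))
          (fun q : ↥(P.primesBelow) ↦ a q * ((q : ℕ) : ℂ) ^ (-circleMap c ρ' α)) x‖ ^ 2) *
          ∫ θ : UnitAddTorus (↥J ⊕ ↥(P.primesBelow)), φ θ
      ≤ ∫ α in (0 : ℝ)..2 * π, (∑ q ∈ Tl P St, (((q : ℕ) : ℝ) ^ (-σ₁)) ^ 2) *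
          ∫ θ : UnitAddTorus (↥J ⊕ ↥(P.primesBelow)), φ θ :=
        intervalIntegral.integral_mono_on (by positivity) (hcont.intervalIntegrable _ _)
          intervalIntegrable_const hle
    _ = 2 * π * (∑ q ∈ Tl P St, (((q : ℕ) : ℝ) ^ (-σ₁)) ^ 2) *
          ∫ θ : UnitAddTorus (↥J ⊕ ↥(P.primesBelow)), φ θ := by
        rw [intervalIntegral.integral_const, smul_eq_mul]; ring

end HybridTorus

end Literature.NumberTheory.LFunctions
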